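import Summits.ResolutionOfSingularities.ResolutionOfSingularities.Theorems.FrobeniusClosingPatchingRelPerfectDepthPhaseCX3Defs
import Summits.ResolutionOfSingularities.ResolutionOfSingularities.Theorems.FrobeniusClosingPatchingRelPerfectDepthPhaseCLocalGamePersistence
import Literature.AlgebraicGeometry.Resolution.SubschemeRegularStalks
import Literature.AlgebraicGeometry.Resolution.NormalCrossingsLocal
import HarnessLib

/-!
# Crux `PatchingRelPerfect` (stmt-ResolutionOfSingularities-16161), chain W5.2 — F7(β) (β-AX) X3 C-I (G2) engine:
# (G-R) REGULARITY OF THE INTRINSIC CENTRES of the locally-monomial game (`X3LemmaM.EndSingComponentsRegular` HOLDS)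

[OURS · L1 W5.2 · res-L1-w52-idea-1 Sketch v19/v20 §4.5 (G-R), design memo `X3-MEASURE-MEMO-4.md` §35.3b, res-L1-w52-plan-1 DESK
REDIRECT 20:33:18Z → res-D-pv-001; line `Cruxes/PatchingRelPerfect/Lines/closed_point_slice.lean`.]  Replaces the role of NO printed
item; NOT a statement of the manuscript under review; fact-free; def-free; any dimension.  AI-written; AI review is weaker than expert review.

THE ARGUMENT (memo-4 §35.3b, with tri-2's typing note 20:23:40Z and tri-1's docline 20:34:28Z).  Let `K` be locally END with letters
from `𝓛` (`IsEndNear`), `m ≥ 1`, and `Y` a maximal irreducible subset of `Sing(K, m) = {ord ≥ m}` (`singGE`).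
* `preimage_singGE_eq_biUnion` — on a presentation open `U` (`K|_U = Σ_{A ∈ 𝒦} Λ^A`, `Λ|_U` snc), `Sing(K, m) ∩ U` is the FINITE union of
  the strata `⋂_{F ∈ T} V(F|_U)` over the letter sets `T ⊆ Λ|_U` on which every row has weight `≥ m` («heavy»; the order of a monomial sum
  at a point is the least row weight there, tree `PolyhedraGame.RouteK.mem_support_monomialSum_marked_iff`); hence
* `isClosed_singGE` — `Sing(K, m)` is closed (no excellence needed: closedness is local and `Sing ⊆ cosupp K`), and a maximal irreducible
  subset of a closed set is closed (`isClosed_of_maximal_irreducible`);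
* `exists_local_stratum` — at `y ∈ Y`: `Y ∩ U` is irreducible, so it lies in ONE heavy stratum; the stratum of ALL letters containing
  `Y ∩ U` is then heavy, regular (`HasSNC.isRegular_subscheme_finsetSup`) and locally irreducible (`exists_opens_isIrreducible_support_inter`);
  on a smaller open `U' ∋ y` its closure is an irreducible subset of `Sing(K, m)` containing `Y`, so BY MAXIMALITY it is `Y`:
  `Y ∩ U' = (⋂_{F ∈ J} Supp F) ∩ U'`, and `𝒪_{X,y}/𝓘_{Y,y}` is the local ring of an snc stratum, regular;
* `endSingComponentsRegular_holds : EndSingComponentsRegular` — the Prop of `…DepthPhaseCX3Defs` BY NAME (the hypothesis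
  `Scheme.IsRegular X` of the Prop is not even used: the snc letters make `U` regular).

## References (for the mathematics; nothing here is a statement of the manuscript under review)
* J. Kollár, *Lectures on Resolution of Singularities* (2007), (3.111) Step 3, Def. 3.25. [Kollar2007]
* E. Bierstone, D. Grigoriev, P. Milman, J. Włodarczyk, arXiv:1206.3090, Def. 3.1.1–3.1.2, §4 Step 2b. [BierstoneGrigorievMilmanWlodarczyk2011]
* The Stacks Project, Tag 0357 (regular ⇒ locally irreducible). [StacksProject]
-/

-- `Summit.<Summit>.<Sub>.Theorems` with `Sub = Summit` (single-conjunct summit, D-0017)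
set_option linter.dupNamespace false

noncomputable section

open CategoryTheory AlgebraicGeometry TopologicalSpace IsLocalRing
open Literature.AlgebraicGeometry.Resolution
open Scheme.IdealSheafData

namespace Summit.ResolutionOfSingularities.ResolutionOfSingularities.Theorems

namespace X3LemmaM

open DepthTargets (monomialSum)
open DepthMultiHost (comap_monomialSum_map boundaryOf_map_comap)
open PolyhedraGame.RouteK (mem_support_monomialSum_marked_iff)

universe u

variable {X : Scheme.{u}}

/-! ## §1 `Sing(K, m)` on a presentation open: a finite union of snc strata -/

section Presentation

variable {K : X.IdealSheafData} {m : ℕ} {U : X.Opens} {Λ : List X.IdealSheafData} {𝒦 : List (List (X.IdealSheafData × ℕ))}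
  (hsnc : HasSNC (Λ.map fun F => F.comap U.ι)) (hbd : ∀ L ∈ 𝒦, boundaryOf L = Λ)
  (hK : K.comap U.ι = (monomialSum 𝒦).comap U.ι)

include hbd in
/-- The restricted rows have the restricted letters as boundary. [folklore] -/
theorem boundaryOf_of_mem_map_rows :
    ∀ A ∈ 𝒦.map (fun A => A.map fun p => (p.1.comap U.ι, p.2)), boundaryOf A = Λ.map fun F => F.comap U.ι := by
  intro A hA
  obtain ⟨L, hL, rfl⟩ := List.mem_map.mp hA
  rw [boundaryOf_map_comap, hbd L hL]

include hsnc hbd in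
/-- The restricted rows have snc boundaries. [folklore] -/
theorem hasSNC_boundaryOf_of_mem_map_rows :
    ∀ A ∈ 𝒦.map (fun A => A.map fun p => (p.1.comap U.ι, p.2)), HasSNC (boundaryOf A) := fun A hA => by
  rw [boundaryOf_of_mem_map_rows hbd A hA]; exact hsnc

include hsnc hbd hK in
/-- **`Sing(K, m) ∩ U` read off the row weights**: for `u ∈ U`, `u ∈ Sing(K, m)` iff every restricted row has weight `≥ m` at `u`.
[cite: BierstoneGrigorievMilmanWlodarczyk2011, §4 Step 2b] -/
theorem mem_singGE_iff_forall_weightAt (u : (U : Scheme.{u})) :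
    U.ι u ∈ singGE K m ↔ ∀ A ∈ 𝒦.map (fun A => A.map fun p => (p.1.comap U.ι, p.2)), m ≤ weightAt A u := by
  have h1 : (⟨K.comap U.ι, [], m⟩ : MarkedIdeal (U : Scheme.{u})).support = U.ι ⁻¹' singGE K m :=
    MarkedIdeal.support_comap_of_etale U.ι (⟨K, [], m⟩ : MarkedIdeal X) []
  have h2 : U.ι u ∈ singGE K m ↔ u ∈ (⟨K.comap U.ι, [], m⟩ : MarkedIdeal (U : Scheme.{u})).support := by
    rw [h1]; rfl
  rw [h2, hK, comap_monomialSum_map]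
  exact mem_support_monomialSum_marked_iff _ (hasSNC_boundaryOf_of_mem_map_rows hsnc hbd) [] m u

include hsnc hbd hK in
/-- **The heavy strata lie in `Sing(K, m)`**: if every restricted row has weight `≥ m` on the letter set `T`, then
`⋂_{G ∈ T} V(G) ⊆ Sing(K, m) ∩ U`. [cite: Kollar2007, (3.111) Step 3] -/
theorem support_finsetSup_subset_preimage_singGE {T : Finset (U : Scheme.{u}).IdealSheafData}
    (hT : ∀ A ∈ 𝒦.map (fun A => A.map fun p => (p.1.comap U.ι, p.2)), m ≤ weightOf A T) :
    ((T.sup id).support : Set (U : Scheme.{u})) ⊆ U.ι ⁻¹' singGE K m := by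
  intro u hu
  rw [Set.mem_preimage, mem_singGE_iff_forall_weightAt hsnc hbd hK]
  intro A hA
  have h := support_finsetSup_subset_support_monomialMarked (hasSNC_boundaryOf_of_mem_map_rows hsnc hbd A hA) (hT A hA) hu
  rwa [mem_support_monomialMarked_iff (hasSNC_boundaryOf_of_mem_map_rows hsnc hbd A hA)] at h

include hsnc hbd hK in
open scoped Classical in
/-- **`Sing(K, m) ∩ U` is the finite union of the heavy strata** (over the letter sets `T ⊆ Λ|_U` on which every row weighs `≥ m`).
[cite: BierstoneGrigorievMilmanWlodarczyk2011, §4 Step 2b] -/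
theorem preimage_singGE_eq_biUnion :
    U.ι ⁻¹' singGE K m = ⋃ T ∈ (Λ.map fun F => F.comap U.ι).toFinset.powerset.filter
      (fun T => ∀ A ∈ 𝒦.map (fun A => A.map fun p => (p.1.comap U.ι, p.2)), m ≤ weightOf A T),
        ((T.sup id).support : Set (U : Scheme.{u})) := by
  ext u
  constructor
  · intro hu
    -- the letters through `u`
    set T : Finset (U : Scheme.{u}).IdealSheafData := (Λ.map fun F => F.comap U.ι).toFinset.filter fun G => u ∈ G.support with hTdef
    have hdiv : ∀ A ∈ 𝒦.map (fun A => A.map fun p => (p.1.comap U.ι, p.2)), divThrough A u = T := by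
      intro A hA
      ext G
      rw [mem_divThrough_iff, hTdef, Finset.mem_filter, List.mem_toFinset, boundaryOf_of_mem_map_rows hbd A hA]
    have hT : ∀ A ∈ 𝒦.map (fun A => A.map fun p => (p.1.comap U.ι, p.2)), m ≤ weightOf A T := by
      intro A hA
      have h := (mem_singGE_iff_forall_weightAt hsnc hbd hK u).mp hu A hA
      rwa [weightAt_eq_weightOf_divThrough, hdiv A hA] at h
    have huT : u ∈ ((T.sup id).support : Set (U : Scheme.{u})) := by
      rw [SetLike.mem_coe, mem_support_finsetSup_iff]
      intro G hG
      exact (Finset.mem_filter.mp hG).2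
    refine Set.mem_iUnion₂.mpr ⟨T, ?_, huT⟩
    rw [Finset.mem_filter, Finset.mem_powerset]
    exact ⟨Finset.filter_subset _ _, hT⟩
  · intro hu
    obtain ⟨T, hT, huT⟩ := Set.mem_iUnion₂.mp hu
    rw [Finset.mem_filter] at hT
    exact support_finsetSup_subset_preimage_singGE hsnc hbd hK hT.2 huT

include hsnc hbd hK in
open scoped Classical in
/-- Hence `Sing(K, m) ∩ U` is closed in `U`. [folklore] -/
theorem isClosed_preimage_singGE : IsClosed (U.ι ⁻¹' singGE K m) := by
  rw [preimage_singGE_eq_biUnion hsnc hbd hK]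
  exact isClosed_biUnion_finset fun T _ => (T.sup id).support.isClosed

omit X in
/-- An irreducible set covered by finitely many closed sets lies in one of them. [folklore] -/
theorem _root_.IsIrreducible.exists_subset_of_subset_biUnion_finset {α ι : Type*} [TopologicalSpace α] {S : Set α}
    (hS : IsIrreducible S) (F : Finset ι) (Z : ι → Set α) (hZ : ∀ i ∈ F, IsClosed (Z i)) (h : S ⊆ ⋃ i ∈ F, Z i) :
    ∃ i ∈ F, S ⊆ Z i := by
  classical
  have hcover : S ⊆ ⋃₀ ↑(F.image Z) := by
    rw [Finset.coe_image, Set.sUnion_image]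
    simpa only [Finset.mem_coe] using h
  obtain ⟨z, hz, hSz⟩ := (isIrreducible_iff_sUnion_isClosed.mp hS) _ (fun z hz => by
    obtain ⟨i, hi, rfl⟩ := Finset.mem_image.mp hz
    exact hZ i hi) hcover
  obtain ⟨i, hi, rfl⟩ := Finset.mem_image.mp hz
  exact ⟨i, hi, hSz⟩

include hsnc hbd hK in
open scoped Classical in
/-- **An irreducible subset of `Sing(K, m) ∩ U` lies in ONE heavy stratum.** [folklore] -/
theorem exists_heavy_of_isIrreducible {S : Set (U : Scheme.{u})} (hS : IsIrreducible S) (hSsub : S ⊆ U.ι ⁻¹' singGE K m) :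
    ∃ T : Finset (U : Scheme.{u}).IdealSheafData, (∀ G ∈ T, G ∈ Λ.map fun F => F.comap U.ι) ∧
      (∀ A ∈ 𝒦.map (fun A => A.map fun p => (p.1.comap U.ι, p.2)), m ≤ weightOf A T) ∧
      S ⊆ ((T.sup id).support : Set (U : Scheme.{u})) := by
  have h := hSsub
  rw [preimage_singGE_eq_biUnion hsnc hbd hK] at h
  obtain ⟨T, hT, hST⟩ := hS.exists_subset_of_subset_biUnion_finset _ _ (fun T _ => (T.sup id).support.isClosed) h
  rw [Finset.mem_filter, Finset.mem_powerset] at hT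
  exact ⟨T, fun G hG => List.mem_toFinset.mp (hT.1 hG), hT.2, hST⟩

end Presentation

/-! ## §2 `Sing(K, m)` is closed; maximal irreducible subsets of it are closed -/

/-- For `m ≥ 1`, `Sing(K, m) ⊆ cosupp K`. [folklore] -/
theorem singGE_subset_support (K : X.IdealSheafData) {m : ℕ} (hm : 1 ≤ m) : singGE K m ⊆ (K.support : Set X) := by
  intro x hx
  have hx' := (MarkedIdeal.mem_support_iff (⟨K, [], m⟩ : MarkedIdeal X) x).mp hx
  rw [SetLike.mem_coe, mem_support_iff_stalkIdeal_le]
  exact hx'.trans (Ideal.pow_le_self (Nat.one_le_iff_ne_zero.mp hm))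

/-- **`Sing(K, m)` of a locally-END ideal is closed** (`m ≥ 1`; closedness is local, and locally `Sing` is a finite union of strata).
[cite: BierstoneGrigorievMilmanWlodarczyk2011, §4 Step 2b] -/
theorem isClosed_singGE (K : X.IdealSheafData) (𝓛 : List X.IdealSheafData) {m : ℕ} (hm : 1 ≤ m)
    (hEnd : ∀ x ∈ (K.support : Set X), IsEndNear K 𝓛 x) : IsClosed (singGE K m) := by
  rw [← isOpen_compl_iff, isOpen_iff_forall_mem_open]
  intro x hx
  by_cases hxK : x ∈ (K.support : Set X)
  · obtain ⟨Λ, -, U, hxU, hsnc, 𝒦, hbd, -, hK⟩ := hEnd x hxK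
    have hcl := isClosed_preimage_singGE (m := m) hsnc hbd hK
    refine ⟨U.ι '' (U.ι ⁻¹' singGE K m)ᶜ, ?_, U.ι.isOpenEmbedding.isOpenMap _ hcl.isOpen_compl,
      ⟨(⟨x, hxU⟩ : (U : Scheme.{u})), hx, rfl⟩⟩
    rintro _ ⟨u, hu, rfl⟩
    exact hu
  · exact ⟨(K.support : Set X)ᶜ, fun y hy hy' => hy (singGE_subset_support K hm hy'), K.support.isClosed.isOpen_compl, hxK⟩

omit X in
/-- A maximal irreducible subset of a closed set is closed. [folklore] -/
theorem isClosed_of_maximal_irreducible {α : Type u} [TopologicalSpace α] {S Y : Set α} (hS : IsClosed S)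
    (hY : IsIrreducible Y) (hYS : Y ⊆ S) (hmax : ∀ Y' : Set α, IsIrreducible Y' → Y ⊆ Y' → Y' ⊆ S → Y' = Y) : IsClosed Y := by
  have h := hmax (closure Y) hY.closure subset_closure (hS.closure_subset_iff.mpr hYS)
  rw [← h]
  exact isClosed_closure

/-! ## §3 The local stratum at a point of a maximal irreducible subset -/

/-- Stalks of the vanishing ideals of two closed sets with the same trace on an open neighbourhood (given by an open immersion `j`)
agree at the points of that neighbourhood. [folklore] -/
theorem stalkIdeal_vanishingIdeal_eq_of_preimage_eq {W Y : Scheme.{u}} (j : W ⟶ Y) [IsOpenImmersion j] (Z Z' : Closeds Y)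
    (h : Z.preimage j.continuous = Z'.preimage j.continuous) (w : W) :
    stalkIdeal (vanishingIdeal Z) (j w) = stalkIdeal (vanishingIdeal Z') (j w) := by
  have key : ∀ T : Closeds Y, stalkIdeal (vanishingIdeal T) (j w) =
      (stalkIdeal (vanishingIdeal (T.preimage j.continuous)) w).comap (j.stalkMap w).hom := by
    intro T
    rw [← comap_vanishingIdeal_of_isOpenImmersion, stalkIdeal_comap_of_isOpenImmersion,
      Ideal.comap_map_of_bijective _ (ConcreteCategory.bijective_of_isIso (j.stalkMap w))]
  rw [key Z, key Z', h]

section Local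

variable [IsNoetherian X] (K : X.IdealSheafData) (𝓛 : List X.IdealSheafData) {m : ℕ} (hm : 1 ≤ m)
  (hEnd : ∀ x ∈ (K.support : Set X), IsEndNear K 𝓛 x) {Y : Set X} (hYirr : IsIrreducible Y) (hYsub : Y ⊆ singGE K m)
  (hYmax : ∀ Y' : Set X, IsIrreducible Y' → Y ⊆ Y' → Y' ⊆ singGE K m → Y' = Y)

include hm hEnd hYirr hYsub hYmax in
open scoped Classical in
/-- **The local stratum.**  At `y ∈ Y` (a maximal irreducible subset of `Sing(K, m)`): a local END presentation `(U, Λ, 𝒦)` of `K` at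
`y`, a sub-list `J ⊆ Λ` with `Y ∩ U = (⋂_{F ∈ J} Supp F) ∩ U`, and `𝒪_{X,y}/𝓘_{Y,y}` regular.
[cite: Kollar2007, (3.111) Step 3, Def. 3.25] [cite: StacksProject, Tag 0357] -/
theorem exists_local_stratum (hY : IsClosed Y) {y : X} (hy : y ∈ Y) :
    (∃ (U : X.Opens) (Λ J : List X.IdealSheafData) (𝒦 : List (List (X.IdealSheafData × ℕ))),
      IsEndPresentation K 𝓛 y U Λ 𝒦 ∧ (∀ F ∈ J, F ∈ Λ) ∧ Y ∩ (U : Set X) = (⋂ F ∈ J, (F.support : Set X)) ∩ (U : Set X)) ∧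
    IsRegularLocalRing (X.presheaf.stalk y ⧸ stalkIdeal (vanishingIdeal ⟨Y, hY⟩) y) := by
  have hSing : IsClosed (singGE K m) := isClosed_singGE K 𝓛 hm hEnd
  obtain ⟨Λ, hΛ, U, hyU, hsnc, 𝒦, hbd, hne, hK⟩ := hEnd y (singGE_subset_support K hm (hYsub hy))
  -- the trace of `Y` on `U`
  set y₀ : (U : Scheme.{u}) := ⟨y, hyU⟩ with hy₀
  set YU : Set (U : Scheme.{u}) := U.ι ⁻¹' Y with hYU
  have hy₀Y : y₀ ∈ YU := hy
  have hYUirr : IsIrreducible YU := ⟨⟨y₀, hy₀Y⟩, hYirr.2.preimage U.ι.isOpenEmbedding⟩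
  have hYUsub : YU ⊆ U.ι ⁻¹' singGE K m := fun u hu => hYsub hu
  -- the stratum of ALL letters containing `Y ∩ U`
  set D : Finset (U : Scheme.{u}).IdealSheafData :=
    (Λ.map fun F => F.comap U.ι).toFinset.filter fun G => YU ⊆ (G.support : Set (U : Scheme.{u})) with hD
  have hDΛ : ∀ G ∈ D, G ∈ Λ.map fun F => F.comap U.ι := fun G hG => List.mem_toFinset.mp (Finset.mem_filter.mp hG).1
  set C : (U : Scheme.{u}).IdealSheafData := D.sup id with hC
  have hCreg : Scheme.IsRegular C.subscheme := hsnc.isRegular_subscheme_finsetSup D hDΛ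
  have hYC : YU ⊆ (C.support : Set (U : Scheme.{u})) := by
    intro u hu
    rw [SetLike.mem_coe, mem_support_finsetSup_iff]
    exact fun G hG => (Finset.mem_filter.mp hG).2 hu
  -- `Y ∩ U` lies in ONE heavy stratum `T₀ ⊆ D`, so `D` is heavy
  have hDheavy : ∀ A ∈ 𝒦.map (fun A => A.map fun p => (p.1.comap U.ι, p.2)), m ≤ weightOf A D := by
    obtain ⟨T₀, hT₀Λ, hT₀, hYT₀⟩ := exists_heavy_of_isIrreducible hsnc hbd hK hYUirr hYUsub
    have hT₀D : T₀ ⊆ D := by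
      intro G hG
      rw [hD, Finset.mem_filter, List.mem_toFinset]
      exact ⟨hT₀Λ G hG, fun u hu => (mem_support_finsetSup_iff T₀ u).mp (hYT₀ hu) G hG⟩
    exact fun A hA => (hT₀ A hA).trans (weightOf_mono A hT₀D)
  have hCsing : (C.support : Set (U : Scheme.{u})) ⊆ U.ι ⁻¹' singGE K m :=
    support_finsetSup_subset_preimage_singGE hsnc hbd hK hDheavy
  -- shrink to an open on which the stratum is irreducible
  obtain ⟨V, hyV, hirr⟩ := exists_opens_isIrreducible_support_inter C hCreg (hYC hy₀Y)
  -- MAXIMALITY: the closure of the stratum piece is an irreducible subset of `Sing` containing `Y`, hence it is `Y`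
  have hWY : closure (U.ι '' ((C.support : Set (U : Scheme.{u})) ∩ (V : Set (U : Scheme.{u})))) = Y := by
    refine hYmax _ (hirr.image _ U.ι.continuous.continuousOn).closure ?_ ?_
    · have hO : IsOpen (U.ι '' (V : Set (U : Scheme.{u}))) := U.ι.isOpenEmbedding.isOpenMap _ V.2
      have h1 : Y ⊆ closure (Y ∩ U.ι '' (V : Set (U : Scheme.{u}))) :=
        subset_closure_inter_of_isPreirreducible_of_isOpen hYirr.2 hO ⟨y, hy, y₀, hyV, rfl⟩
      refine h1.trans (closure_mono ?_)
      rintro _ ⟨hz, u, huV, rfl⟩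
      exact ⟨u, ⟨hYC hz, huV⟩, rfl⟩
    · refine hSing.closure_subset_iff.mpr ?_
      rintro _ ⟨u, ⟨hu, -⟩, rfl⟩
      exact hCsing hu
  have hCY : (C.support : Set (U : Scheme.{u})) ∩ (V : Set (U : Scheme.{u})) ⊆ YU := by
    intro u hu
    change U.ι u ∈ Y
    rw [← hWY]
    exact subset_closure ⟨u, hu, rfl⟩
  -- the smaller open `U' = ι(V)` of `X` and the global letters `J`
  set U' : X.Opens := U.ι ''ᵁ V with hU'
  have hle : U' ≤ U := by
    rintro _ ⟨u, -, rfl⟩; exact u.2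
  set J : List X.IdealSheafData := Λ.filter fun F => F.comap U.ι ∈ D with hJ
  refine ⟨⟨U', Λ, J, 𝒦, ⟨⟨y₀, hyV, rfl⟩, hΛ, hasSNC_map_comap_ι_of_le hle hsnc, hbd, hne, comap_ι_eq_of_le hle hK⟩,
    fun F hF => (List.mem_filter.mp hF).1, ?_⟩, ?_⟩
  · -- `Y ∩ U' = (⋂_{F ∈ J} Supp F) ∩ U'`
    ext z
    constructor
    · rintro ⟨hzY, u, huV, rfl⟩
      refine ⟨Set.mem_iInter₂.mpr fun F hF => ?_, u, huV, rfl⟩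
      have hFD : F.comap U.ι ∈ D := by simpa using (List.mem_filter.mp hF).2
      have h : u ∈ ((F.comap U.ι).support : Set (U : Scheme.{u})) := (Finset.mem_filter.mp hFD).2 (show u ∈ YU from hzY)
      rw [Scheme.IdealSheafData.support_comap] at h
      exact h
    · rintro ⟨hz, u, huV, rfl⟩
      refine ⟨?_, u, huV, rfl⟩
      change u ∈ YU
      refine hCY ⟨?_, huV⟩
      rw [SetLike.mem_coe, mem_support_finsetSup_iff]
      intro G hG
      obtain ⟨F, hFΛ, rfl⟩ := List.mem_map.mp (hDΛ G hG)
      have hFJ : F ∈ J := List.mem_filter.mpr ⟨hFΛ, by simpa using hG⟩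
      have h : u ∈ ((F.comap U.ι).support : Set (U : Scheme.{u})) := by
        rw [Scheme.IdealSheafData.support_comap]
        exact Set.mem_iInter₂.mp hz F hFJ
      exact h
  · -- regularity of `𝒪_{X,y}/𝓘_{Y,y}`: it is `𝒪_{U,y₀}/C_{y₀}`
    have hq : IsRegularLocalRing ((U : Scheme.{u}).presheaf.stalk y₀ ⧸ stalkIdeal C y₀) :=
      (Scheme.isRegular_subscheme_iff C).mp hCreg y₀ (hYC hy₀Y)
    -- `C = 𝓘_{supp C}`, and `𝓘_{supp C}`, `𝓘_{Y ∩ U}` have the same stalk at `y₀` (equal traces on `V`)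
    have hCv : C = vanishingIdeal C.support := eq_vanishingIdeal_support_of_isRegular C hCreg
    have hYUV : ((⟨Y, hY⟩ : Closeds X).preimage U.ι.continuous).preimage V.ι.continuous = C.support.preimage V.ι.continuous := by
      apply Closeds.ext
      simp only [Closeds.coe_preimage]
      ext v
      constructor
      · intro hv
        exact (show V.ι v ∈ (C.support : Set (U : Scheme.{u})) ∩ (V : Set (U : Scheme.{u})) from ⟨hYC hv, v.2⟩).1
      · intro hv
        exact hCY ⟨hv, v.2⟩
    have hst : stalkIdeal (vanishingIdeal (((⟨Y, hY⟩ : Closeds X).preimage U.ι.continuous))) y₀ = stalkIdeal C y₀ := by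
      have h := stalkIdeal_vanishingIdeal_eq_of_preimage_eq V.ι _ _ hYUV ⟨y₀, hyV⟩
      rw [← hCv] at h
      exact h
    have hmap : stalkIdeal ((vanishingIdeal ⟨Y, hY⟩).comap U.ι) y₀ =
        (stalkIdeal (vanishingIdeal ⟨Y, hY⟩) y).map (U.ι.stalkMap y₀).hom :=
      stalkIdeal_comap_of_isOpenImmersion U.ι _ y₀
    rw [comap_vanishingIdeal_of_isOpenImmersion, hst] at hmap
    let φ : X.presheaf.stalk y ≃+* (U : Scheme.{u}).presheaf.stalk y₀ := (asIso (U.ι.stalkMap y₀)).commRingCatIsoToRingEquiv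
    have hφ : stalkIdeal C y₀ = (stalkIdeal (vanishingIdeal ⟨Y, hY⟩) y).map (φ : X.presheaf.stalk y →+* _) := hmap
    exact IsRegularLocalRing.of_ringEquiv (Ideal.quotientEquiv _ _ φ hφ).symm

end Local

/-! ## §4 (G-R) by name -/

/-- [OURS · L1 W5.2] **(G-R) REGULARITY OF INTRINSIC CENTRES HOLDS** (`X3LemmaM.EndSingComponentsRegular` of `…DepthPhaseCX3Defs`):
for a locally-END ideal `K` and `m ≥ 1`, a maximal irreducible subset `Y` of `Sing(K, m)` is closed, its reduced induced subscheme is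
regular, and near each of its points it is the stratum `⋂_{F ∈ J} Supp F` of a sub-family `J` of the letters of a local END presentation.
[cite: Kollar2007, (3.111) Step 3, Def. 3.25] [cite: BierstoneGrigorievMilmanWlodarczyk2011, §4 Step 2b] [cite: StacksProject, Tag 0357] -/
theorem endSingComponentsRegular_holds : EndSingComponentsRegular.{u} := by
  intro X _ _ K 𝓛 m hm hEnd Y hYirr hYsub hYmax
  have hY : IsClosed Y := isClosed_of_maximal_irreducible (isClosed_singGE K 𝓛 hm hEnd) hYirr hYsub hYmax
  refine ⟨hY, ?_, fun y hy => (exists_local_stratum K 𝓛 hm hEnd hYirr hYsub hYmax hY hy).1⟩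
  refine Scheme.isRegular_subscheme_of_forall _ fun y hy => ?_
  have hy' : y ∈ Y := by
    have h : y ∈ ((vanishingIdeal (⟨Y, hY⟩ : Closeds X)).support : Set X) := hy
    rwa [Scheme.IdealSheafData.coe_support_vanishingIdeal] at h
  exact (exists_local_stratum K 𝓛 hm hEnd hYirr hYsub hYmax hY hy').2

end X3LemmaM

end Summit.ResolutionOfSingularities.ResolutionOfSingularities.Theorems

end
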